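import Mathlib
import Summits.NavierStokesRegularity.NavierStokesRegularity.Theorems.EulerZoomLiouvillePowerGaugeEulerLiouvilleHelicityTubeLocalKelvin
import Summits.NavierStokesRegularity.NavierStokesRegularity.Theorems.EulerZoomLiouvillePowerGaugeEulerLiouvilleHelicityTubeTransport
import Summits.NavierStokesRegularity.NavierStokesRegularity.Theorems.EulerZoomLiouvillePowerGaugeEulerLiouvilleAnchoredBudgetCutoffFlow
import HarnessLib

/-!
# Crux `EulerZoomLiouville.PowerGaugeEulerLiouville` (stmt-NavierStokesRegularity-19832), line `helicity-tube` rev4, stub T1′ — part 2: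
# TUBE DATA PERSIST BACKWARD WITH THEIR HELICITY — GRADIENT-FREE (the cutoff-field flow replaces the global particle flow)

Route №10 `EulerZoomLiouville` (NavierStokesRegularity), crux E.  Line `helicity-tube` (ideator ns-idea-11 g4;
`Cruxes/PowerGaugeEulerLiouville/Lines/helicity_tube.lean` rev4 985d9ffb2a69), stub **T1 `stub_tubeTransport` in its GRADIENT-FREE text**
(`IsDriftingPastWith` := classical on `(−∞,0)` ∧ `T₁ ≤ 0` ∧ `0 ≤ M` ∧ `κ < 1` ∧ velocity envelope — NO clause on the gradient).  The rev1 text WITH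
the clause is LANDED (`HelicityTube.tubesPersist_of_driftingPastWith`, ns-ezl-w5 g0, p628643).  Here, exactly as the card (rev2/rev4) prescribes, the
Literature flow kit runs on the CUTOFF FIELD `ψ·u`, `ψ = 1` on `B̄(0, R + 3D + 2)` (`D` = drift radius), via the `anchored-budget` kit
(`AnchoredBudget.isUniformlyLipschitzOn_cutoff`, `hasDerivAt_cutoffFlow_of_mem`, `det_fderiv_cutoffFlow_eq_one`, p631088):

* CONFINEMENT (`SwirlfreeLedger.norm_evolutionMap_sub_le` on `ψu`, `‖ψu‖ ≤ ‖u‖ ≤ M(−r)^{−κ}`): every label moves at most `D`; the labels of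
  `B(0, R + D + 1)` stay in the plateau on `[s, τ]`, so near them the cutoff flow IS the particle flow;
* the avatar `χ' = χ ∘ X` (`X` = cutoff flow from `s` to `τ`) is a tube datum of `u(s)` inside `B(0, R + D)`: first integral by the LOCAL Cauchy
  formula `HelicityTube.curl_flow_eq_local` (part 1) on the good labels, identically zero near the others;
* SAME HELICITY: the LOCAL Kelvin identity `HelicityTube.integral_inner_flow_eq_local` (part 1) with the test field `B = χ' · curl u(s)` (supported
  in the good labels), the local Cauchy formula, and the change of variables on the good labels (Jacobian one there, `setIntegral_image_cutoffFlow_eq`).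

* `setIntegral_image_cutoffFlow_eq` — Bochner change of variables under the cutoff flow on a measurable set of STAY labels;
* `tubesPersist_of_driftingPastWith_free` — **T1′ = `Sig.stub_tubeTransport` (rev4, gradient-free) with `IsDriftingPastWith`, `TubesPersist`,
  `IsTubeWeight`, `weightedHelicity`, `driftRadius` UNFOLDED VERBATIM.**

WHAT THIS IS NOT: not NS regularity, not the crux E — ONE line stub `--supports` stmt-19832; Moffatt's partial-helicity invariance for classical flows.
[cite: MajdaBertozziCUP2002, §1.3 Prop. 1.4, §1.6 Props. 1.8, 1.10–1.12; ConstantinIgnatovaVicol2026Putative, §3.4.1–3.4.2]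
-/

noncomputable section

-- flat `Theorems/<Route><Decl>…` files of one crux share the namespace of the crux (tree convention)
set_option linter.dupNamespace false

open MeasureTheory Set Filter Topology Metric Function InnerProductSpace
open scoped RealInnerProductSpace NNReal ENNReal ContDiff

namespace Summit.NavierStokesRegularity.NavierStokesRegularity.Theorems.PowerGaugeEulerLiouville.HelicityTube

open Literature.Analysis Literature.Analysis.FluidPDE Literature.Analysis.ODE
open Summit.NavierStokesRegularity.NavierStokesRegularity.Theorems.PowerGaugeEulerLiouville.SwirlfreeLedger (norm_evolutionMap_sub_le)
open Summit.NavierStokesRegularity.NavierStokesRegularity.Theorems.PowerGaugeEulerLiouville.AnchoredBudget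
  (isSmoothSpaceTimeOn_cutoff isUniformlyLipschitzOn_cutoff hasDerivAt_cutoffFlow_of_mem det_fderiv_cutoffFlow_eq_one)

variable {u : ℝ → EuclideanSpace ℝ (Fin 3) → EuclideanSpace ℝ (Fin 3)} {p : ℝ → EuclideanSpace ℝ (Fin 3) → ℝ} {S : Set ℝ}

/-- **Change of variables under the cutoff flow on STAY labels (Bochner form)**: `∫_{X_t A} g = ∫_A g ∘ X_t` for a measurable set `A` of labels
whose cutoff-flow trajectories stay in the plateau ball between `t₀` and `t` (Jacobian one there; injectivity of the global cutoff flow).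
[cite: MajdaBertozziCUP2002, §1.3 Prop. 1.4] -/
theorem setIntegral_image_cutoffFlow_eq (hcl : IsClassicalEulerSolutionOn S 0 u p) (hS : Convex ℝ S) (hU : UniqueDiffOn ℝ S)
    (φ : ContDiffBump (0 : EuclideanSpace ℝ (Fin 3))) {t₀ t : ℝ} (ht₀ : t₀ ∈ S) (ht : t ∈ S) {A : Set (EuclideanSpace ℝ (Fin 3))}
    (hAm : MeasurableSet A)
    (hstay : ∀ ξ ∈ A, ∀ σ ∈ uIcc t₀ t, ODE.evolutionMap (fun t x => (φ : EuclideanSpace ℝ (Fin 3) → ℝ) x • u t x) t₀ σ ξ ∈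
      ball (0 : EuclideanSpace ℝ (Fin 3)) φ.rIn)
    (g : EuclideanSpace ℝ (Fin 3) → ℝ) :
    ∫ x in ODE.evolutionMap (fun t x => (φ : EuclideanSpace ℝ (Fin 3) → ℝ) x • u t x) t₀ t '' A, g x =
      ∫ a in A, g (ODE.evolutionMap (fun t x => (φ : EuclideanSpace ℝ (Fin 3) → ℝ) x • u t x) t₀ t a) := by
  have hL := isUniformlyLipschitzOn_cutoff hcl.smooth_velocity hU φ
  have hsm := isSmoothSpaceTimeOn_cutoff hcl.smooth_velocity φ
  set X := ODE.evolutionMap (fun t x => (φ : EuclideanSpace ℝ (Fin 3) → ℝ) x • u t x) t₀ t with hX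
  have hdiff : ∀ x ∈ A, HasFDerivWithinAt X (fderiv ℝ X x) A x := fun x _ =>
    (((hL.contDiff_evolutionMap hS hU le_top hsm ht₀ ht).differentiable (by simp)) x).hasFDerivAt.hasFDerivWithinAt
  have hinj : InjOn X A := (hL.bijective_evolutionMap hS ht₀ ht).injective.injOn
  rw [integral_image_eq_integral_abs_det_fderiv_smul volume hAm hdiff hinj]
  refine setIntegral_congr_fun hAm fun a ha => ?_
  rw [hX, det_fderiv_cutoffFlow_eq_one hcl hS hU φ ht₀ ht (hstay a ha)]
  simp

/-- **T1′ · TUBE DATA PERSIST BACKWARD WITH THEIR HELICITY on a drifting classical far past — GRADIENT-FREE** (the rev4 text of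
`Sig.stub_tubeTransport`, defs unfolded): for a classical Euler solution on `(−∞,0) × ℝ³` with `T₁ ≤ 0`, `0 ≤ M`, `κ < 1` and the velocity envelope
`‖u(r,x)‖ ≤ M(−r)^{−κ}` for `r < T₁` (NOTHING on the gradient), every tube datum `(χ, R)` of `u(τ)`, `τ < T₁` (`χ ∈ C^∞`, `|χ| ≤ 1`, `χ = 0` off
`B(0,R)`, `Dχ[curl u(τ)] ≡ 0`) has at every earlier time `s < τ` an avatar `χ'` — a tube datum of `u(s)` inside `B(0, R + M((−s)^{1−κ} − (−τ)^{1−κ})/(1−κ))`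
— with the SAME weighted helicity.  (`χ' = χ ∘ X`, `X` the flow of the cutoff field `ψu` from `s` to `τ`, which is the particle flow on the labels of
`B(0, R + D + 1)`.) [cite: MajdaBertozziCUP2002, §1.6 Props. 1.8, 1.10–1.12; §2.5 (2.115)–(2.117)] -/
theorem tubesPersist_of_driftingPastWith_free :
    ∀ (u : ℝ → EuclideanSpace ℝ (Fin 3) → EuclideanSpace ℝ (Fin 3)) (p : ℝ → EuclideanSpace ℝ (Fin 3) → ℝ) (T₁ M κ : ℝ),
      (IsClassicalEulerSolutionOn (Set.Iio 0) 0 u p ∧ T₁ ≤ 0 ∧ 0 ≤ M ∧ κ < 1 ∧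
          (∀ τ : ℝ, τ < T₁ → ∀ x : EuclideanSpace ℝ (Fin 3), ‖u τ x‖ ≤ M * (-τ) ^ (-κ))) →
        ∀ τ : ℝ, τ < T₁ → ∀ (χ : EuclideanSpace ℝ (Fin 3) → ℝ) (R : ℝ), 0 < R →
          (ContDiff ℝ ∞ χ ∧ (∀ x : EuclideanSpace ℝ (Fin 3), |χ x| ≤ 1) ∧
              (∀ x : EuclideanSpace ℝ (Fin 3), R ≤ ‖x‖ → χ x = 0) ∧
              ∀ x : EuclideanSpace ℝ (Fin 3), fderiv ℝ χ x (curl (u τ) x) = 0) →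
            ∀ s : ℝ, s < τ →
              ∃ χ' : EuclideanSpace ℝ (Fin 3) → ℝ,
                (ContDiff ℝ ∞ χ' ∧ (∀ x : EuclideanSpace ℝ (Fin 3), |χ' x| ≤ 1) ∧
                    (∀ x : EuclideanSpace ℝ (Fin 3),
                      R + M / (1 - κ) * ((-s) ^ (1 - κ) - (-τ) ^ (1 - κ)) ≤ ‖x‖ → χ' x = 0) ∧
                    ∀ x : EuclideanSpace ℝ (Fin 3), fderiv ℝ χ' x (curl (u s) x) = 0) ∧
                  ∫ x, χ' x * ⟪u s x, curl (u s) x⟫ = ∫ x, χ x * ⟪u τ x, curl (u τ) x⟫ := by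
  intro u p T₁ M κ hdrift τ hτ χ R hR hχ s hs
  obtain ⟨hcl, hT₁, hM0, hκ1, henv⟩ := hdrift
  obtain ⟨hχs, hχ1, hχ0, hχi⟩ := hχ
  have hτ0 : τ < 0 := lt_of_lt_of_le hτ hT₁
  -- the drift radius
  set D : ℝ := M / (1 - κ) * ((-s) ^ (1 - κ) - (-τ) ^ (1 - κ)) with hDdef
  have h1κ : 0 < 1 - κ := by linarith
  have hMκ : 0 ≤ M / (1 - κ) := div_nonneg hM0 h1κ.le
  have hmono : ∀ r ∈ Icc s τ, M / (1 - κ) * ((-r) ^ (1 - κ) - (-τ) ^ (1 - κ)) ≤ D := by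
    intro r hr
    rw [hDdef]
    refine mul_le_mul_of_nonneg_left ?_ hMκ
    have h : (-r) ^ (1 - κ) ≤ (-s) ^ (1 - κ) := Real.rpow_le_rpow (by linarith [hr.2]) (by linarith [hr.1]) h1κ.le
    linarith
  have hD0 : 0 ≤ D := by simpa using hmono τ (right_mem_Icc.2 hs.le)
  -- the time window `S = (s - 1, τ/2)`
  set S : Set ℝ := Ioo (s - 1) (τ / 2) with hSdef
  have hsS : s ∈ S := by rw [hSdef, mem_Ioo]; constructor <;> linarith
  have hτS : τ ∈ S := by rw [hSdef, mem_Ioo]; constructor <;> linarith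
  have hS0 : S ⊆ Iio 0 := fun r hr => by rw [mem_Iio]; rw [hSdef, mem_Ioo] at hr; linarith [hr.2]
  have hSo : IsOpen S := isOpen_Ioo
  have hSc : Convex ℝ S := convex_Ioo _ _
  have hSU : UniqueDiffOn ℝ S := hSo.uniqueDiffOn
  have hclS : IsClassicalEulerSolutionOn S 0 u p := hcl.mono hS0 hSU
  have hIcc : Icc s τ ⊆ S := hSc.ordConnected.out hsS hτS
  -- the cutoff field `w = ψ u`, `ψ = 1` on `B̄(0, R + 3D + 2)`, and its flow
  obtain ⟨φ, hφa⟩ : ∃ φ : ContDiffBump (0 : EuclideanSpace ℝ (Fin 3)), φ.rIn = R + 3 * D + 2 :=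
    ⟨⟨R + 3 * D + 2, R + 3 * D + 3, by linarith, by linarith⟩, rfl⟩
  have hsmw := isSmoothSpaceTimeOn_cutoff hclS.smooth_velocity φ
  have hLip := isUniformlyLipschitzOn_cutoff hclS.smooth_velocity hSU φ
  set X2 : ℝ → EuclideanSpace ℝ (Fin 3) → EuclideanSpace ℝ (Fin 3) :=
    ODE.evolutionMap (fun t x => (φ : EuclideanSpace ℝ (Fin 3) → ℝ) x • u t x) s with hX2def
  set X : EuclideanSpace ℝ (Fin 3) → EuclideanSpace ℝ (Fin 3) := X2 τ with hXdef
  set Y : EuclideanSpace ℝ (Fin 3) → EuclideanSpace ℝ (Fin 3) :=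
    ODE.evolutionMap (fun t x => (φ : EuclideanSpace ℝ (Fin 3) → ℝ) x • u t x) τ s with hYdef
  have hX2s : IsSmoothSpaceTimeOn S X2 := isSmoothSpaceTimeOn_evolutionMap hLip hsmw hSc hSU hsS
  have hXs : ContDiff ℝ ∞ X := contDiff_evolutionMap_slice hLip hsmw hSc hSU hsS hτS
  have hX20 : X2 s = id := funext fun a => ODE.evolutionMap_self _ s a
  have hYX : ∀ a, Y (X a) = a := fun a => hLip.evolutionMap_symm hSc hsS hτS a
  have hXY : ∀ x, X (Y x) = x := fun x => hLip.evolutionMap_symm hSc hτS hsS x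
  have hXsurj : Surjective X := (hLip.bijective_evolutionMap hSc hsS hτS).surjective
  have htrans : ∀ r ∈ S, ∀ a, X2 r a = ODE.evolutionMap (fun t x => (φ : EuclideanSpace ℝ (Fin 3) → ℝ) x • u t x) τ r (X a) :=
    fun r hr a => (hLip.evolutionMap_trans hSc hsS hτS hr a).symm
  -- speed of the cutoff field on `[s, τ]` and confinement
  have hspeed : ∀ r ∈ Icc s τ, ∀ y : EuclideanSpace ℝ (Fin 3),
      ‖(φ : EuclideanSpace ℝ (Fin 3) → ℝ) y • u r y‖ ≤ M * (-r) ^ (-κ) := by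
    intro r hr y
    rw [norm_smul, Real.norm_of_nonneg φ.nonneg]
    calc φ y * ‖u r y‖ ≤ 1 * ‖u r y‖ := mul_le_mul_of_nonneg_right φ.le_one (norm_nonneg _)
      _ = ‖u r y‖ := one_mul _
      _ ≤ M * (-r) ^ (-κ) := henv r (lt_of_le_of_lt hr.2 hτ) y
  have hback : ∀ x, ∀ r ∈ Icc s τ,
      ‖ODE.evolutionMap (fun t x => (φ : EuclideanSpace ℝ (Fin 3) → ℝ) x • u t x) τ r x - x‖ ≤ D := fun x r hr =>
    (norm_evolutionMap_sub_le hLip hSc hSo hsS hτS hτ0 hκ1 hspeed x hr).trans (hmono r hr)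
  have hconf : ∀ x, ‖Y x - x‖ ≤ D := fun x => hback x s ⟨le_rfl, hs.le⟩
  have hXa : ∀ a, ‖X a - a‖ ≤ D := fun a => by
    have h := hconf (X a); rw [hYX] at h; rw [← norm_neg, neg_sub]; exact h
  have hXfar : ∀ a : EuclideanSpace ℝ (Fin 3), R + D ≤ ‖a‖ → R ≤ ‖X a‖ := by
    intro a ha
    have h2 : ‖a‖ - ‖X a‖ ≤ ‖a - X a‖ := norm_sub_norm_le a (X a)
    have h3 : ‖a - X a‖ ≤ D := by rw [← norm_neg, neg_sub]; exact hXa a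
    linarith
  -- GOOD labels `‖a‖ < R + D + 1`: their trajectories stay in the plateau on `[s, τ]`
  have hgood : ∀ a : EuclideanSpace ℝ (Fin 3), ‖a‖ < R + D + 1 → ∀ r ∈ Icc s τ,
      X2 r a ∈ ball (0 : EuclideanSpace ℝ (Fin 3)) φ.rIn := by
    intro a ha r hr
    rw [htrans r (hIcc hr) a, hφa, mem_ball_zero_iff]
    have h1 := hback (X a) r hr
    have h2 : ‖X a‖ ≤ ‖a‖ + D := by linarith [norm_le_norm_add_norm_sub' (X a) a, hXa a]
    calc ‖ODE.evolutionMap (fun t x => (φ : EuclideanSpace ℝ (Fin 3) → ℝ) x • u t x) τ r (X a)‖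
        ≤ ‖X a‖ + ‖ODE.evolutionMap (fun t x => (φ : EuclideanSpace ℝ (Fin 3) → ℝ) x • u t x) τ r (X a) - X a‖ :=
          norm_le_norm_add_norm_sub' _ _
      _ ≤ ‖a‖ + D + D := by linarith
      _ < R + 3 * D + 2 := by linarith
  have hgoodOpen : IsOpen {a : EuclideanSpace ℝ (Fin 3) | ‖a‖ < R + D + 1} := isOpen_lt continuous_norm continuous_const
  have hXu : ∀ a : EuclideanSpace ℝ (Fin 3), ‖a‖ < R + D + 1 → ∀ r ∈ Icc s τ,
      ∀ᶠ a' in 𝓝 a, HasDerivAt (fun r' => X2 r' a') (u r (X2 r a')) r := by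
    intro a ha r hr
    filter_upwards [hgoodOpen.mem_nhds ha] with a' ha'
    exact hasDerivAt_cutoffFlow_of_mem hclS.smooth_velocity hSc hSU φ hsS (hSo.mem_nhds (hIcc hr))
      (ball_subset_closedBall (hgood a' ha' r hr))
  -- the LOCAL Cauchy formula on the good labels
  have hcauchy : ∀ a : EuclideanSpace ℝ (Fin 3), ‖a‖ < R + D + 1 → curl (u τ) (X a) = fderiv ℝ X a (curl (u s) a) :=
    fun a ha => curl_flow_eq_local hclS hSo hX2s hs.le hIcc hX20 a (hXu a ha)
  -- smoothness of the slices
  have hus : ContDiff ℝ ∞ (u s) := hcl.contDiff_velocity (hs.trans hτ0)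
  have hcurls : ContDiff ℝ ∞ (curl (u s)) := contDiff_curl (n := ⊤) (hus.of_le (by exact_mod_cast le_top))
  -- the avatar
  set χ' : EuclideanSpace ℝ (Fin 3) → ℝ := χ ∘ X with hχ'def
  have hχ's : ContDiff ℝ ∞ χ' := hχs.comp hXs
  have hχ'0 : ∀ a : EuclideanSpace ℝ (Fin 3), R + D ≤ ‖a‖ → χ' a = 0 := fun a ha => by
    rw [hχ'def, Function.comp_apply]
    exact hχ0 (X a) (hXfar a ha)
  have hχ'i : ∀ a : EuclideanSpace ℝ (Fin 3), fderiv ℝ χ' a (curl (u s) a) = 0 := by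
    intro a
    by_cases ha : ‖a‖ < R + D + 1
    · have hd1 : DifferentiableAt ℝ χ (X a) := (hχs.differentiable (by simp)) (X a)
      have hd2 : DifferentiableAt ℝ X a := (hXs.differentiable (by simp)) a
      rw [hχ'def, fderiv_comp a hd1 hd2, ContinuousLinearMap.comp_apply, ← hcauchy a ha]
      exact hχi (X a)
    · -- far labels: `χ'` vanishes near `a`
      have hfar : χ' =ᶠ[𝓝 a] fun _ => 0 := by
        have hopen : IsOpen {a' : EuclideanSpace ℝ (Fin 3) | R + D < ‖a'‖} := isOpen_lt continuous_const continuous_norm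
        filter_upwards [hopen.mem_nhds (show R + D < ‖a‖ by rw [not_lt] at ha; linarith)] with a' ha'
        exact hχ'0 a' (le_of_lt ha')
      rw [hfar.fderiv_eq]
      simp
  refine ⟨χ', ⟨hχ's, fun a => hχ1 (X a), hχ'0, hχ'i⟩, ?_⟩
  -- ### the same helicity
  set B : EuclideanSpace ℝ (Fin 3) → EuclideanSpace ℝ (Fin 3) := fun a => χ' a • curl (u s) a with hBdef
  have hB : ContDiff ℝ ∞ B := hχ's.smul hcurls
  have hBzero : ∀ a : EuclideanSpace ℝ (Fin 3), R + D < ‖a‖ → B a = 0 := fun a ha => by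
    simp only [hBdef, hχ'0 a ha.le, zero_smul]
  have hBc : HasCompactSupport B := by
    refine HasCompactSupport.intro (isCompact_closedBall (0 : EuclideanSpace ℝ (Fin 3)) (R + D)) fun a ha => ?_
    rw [mem_closedBall, dist_zero_right, not_le] at ha
    exact hBzero a ha
  have htsupp : tsupport B ⊆ closedBall (0 : EuclideanSpace ℝ (Fin 3)) (R + D) := by
    refine closure_minimal (fun a ha => ?_) isClosed_closedBall
    rw [mem_closedBall, dist_zero_right]
    by_contra h
    exact ha (hBzero a (not_le.1 h))
  have hBdiv : VectorCalculus.IsDivFree B := by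
    intro a
    have hd1 : DifferentiableAt ℝ χ' a := (hχ's.differentiable (by simp)) a
    have hd2 : DifferentiableAt ℝ (curl (u s)) a := (hcurls.differentiable (by simp)) a
    have hdivω : VectorCalculus.divergence (curl (u s)) a = 0 :=
      divergence_curl_eq_zero_holds (u s) (hus.of_le (by norm_cast)) a
    have hgrad' : ⟪curl (u s) a, gradient χ' a⟫ = fderiv ℝ χ' a (curl (u s) a) := by
      rw [gradient, real_inner_comm, InnerProductSpace.toDual_symm_apply]
    show VectorCalculus.divergence (fun y => χ' y • curl (u s) y) a = 0
    rw [divergence_smul_apply hd1 hd2, hdivω, mul_zero, zero_add, hgrad', hχ'i a]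
  -- Kelvin, torus-averaged, LOCAL (the trajectory property holds near `tsupport B ⊆ B̄(0, R+D)`)
  have hK := integral_inner_flow_eq_local hclS hSo hX2s hs.le hIcc hX20 hB hBc hBdiv fun r hr a ha =>
    hXu a (by have := htsupp ha; rw [mem_closedBall, dist_zero_right] at this; linarith) r hr
  have hrhs : ∫ a, ⟪u s a, B a⟫ = ∫ a, χ' a * ⟪u s a, curl (u s) a⟫ := by
    refine integral_congr_ae (ae_of_all _ fun a => ?_)
    simp only [hBdef, real_inner_smul_right]
  -- the left-hand side is `∫ G ∘ X`, `G = χ ⟪u(τ), curl u(τ)⟫`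
  set G : EuclideanSpace ℝ (Fin 3) → ℝ := fun x => χ x * ⟪u τ x, curl (u τ) x⟫ with hGdef
  have hlhs : ∫ a, ⟪u τ (X2 τ a), fderiv ℝ (X2 τ) a (B a)⟫ = ∫ a, G (X a) := by
    refine integral_congr_ae (ae_of_all _ fun a => ?_)
    by_cases ha : ‖a‖ < R + D + 1
    · simp only [hBdef, hGdef, map_smul, real_inner_smul_right]
      rw [← hXdef, ← hcauchy a ha, hχ'def, Function.comp_apply]
    · have h0 : χ' a = 0 := hχ'0 a (by rw [not_lt] at ha; linarith)
      have h0' : χ (X a) = 0 := by simpa [hχ'def] using h0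
      simp only [hBdef, hGdef, h0, zero_smul, map_zero, inner_zero_right, h0', zero_mul]
  -- change of variables on the good labels `A = B(0, R + D + 1)` (Jacobian one there; `G ∘ X` and `G` vanish elsewhere)
  set A : Set (EuclideanSpace ℝ (Fin 3)) := ball 0 (R + D + 1) with hAdef
  have hGzero : ∀ x : EuclideanSpace ℝ (Fin 3), R ≤ ‖x‖ → G x = 0 := fun x hx => by
    simp only [hGdef, hχ0 x hx, zero_mul]
  have hcov : ∫ a, G (X a) = ∫ x, G x := by
    have h1 : ∫ a, G (X a) = ∫ a in A, G (X a) := by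
      refine (setIntegral_eq_integral_of_forall_compl_eq_zero fun a ha => ?_).symm
      rw [hAdef, mem_ball_zero_iff, not_lt] at ha
      exact hGzero (X a) (hXfar a (by linarith))
    have h2 : ∫ x, G x = ∫ x in X '' A, G x := by
      refine (setIntegral_eq_integral_of_forall_compl_eq_zero fun x hx => ?_).symm
      by_contra hG
      have hxR : ‖x‖ < R := by by_contra h'; exact hG (hGzero x (not_lt.1 h'))
      apply hx
      refine ⟨Y x, ?_, hXY x⟩
      rw [hAdef, mem_ball_zero_iff]
      linarith [norm_le_norm_add_norm_sub' (Y x) x, hconf x]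
    have h3 : ∫ x in X '' A, G x = ∫ a in A, G (X a) :=
      setIntegral_image_cutoffFlow_eq hclS hSc hSU φ hsS hτS measurableSet_ball
        (fun ξ hξ σ hσ => hgood ξ (mem_ball_zero_iff.1 hξ) σ (by rwa [uIcc_of_le hs.le] at hσ)) G
    rw [h1, h2, h3]
  rw [← hrhs, ← hK, hlhs, hcov]

end Summit.NavierStokesRegularity.NavierStokesRegularity.Theorems.PowerGaugeEulerLiouville.HelicityTube

end
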